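import Summits.ResolutionOfSingularities.ResolutionOfSingularities.Theses.PAlteration
import Summits.ResolutionOfSingularities.ResolutionOfSingularities.Theorems.PAlterationPialtZariskiLocalResolution
import Summits.ResolutionOfSingularities.ResolutionOfSingularities.Theorems.PAlterationPialtFrobenius
import Summits.ResolutionOfSingularities.ResolutionOfSingularities.Theorems.PAlterationPialtKnownCases
import HarnessLib

/-!
# `Pialt` (crux stmt-ResolutionOfSingularities-0555), line `SketchIdeator2` / Card A:
# `stub_radicialPatching` from `Picover`, two-model patching and Nagata

Helper file for the stub `stub_radicialPatching` (`RadicialPatching_p`) of the lead's skeleton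
`radicially-regular-endgame` (`--supports stmt-ResolutionOfSingularities-0555`; does not close
the item; STUB-PLAN `Cruxes/Pialt/STUB-PLAN-stub_radicialPatching.md`, whose spine H1–H4/H6 — one
common purely inseparable field for all charts — is SHORT-CIRCUITED here over perfect fields by
Frobenius domination).

The stub: over a PERFECT field `k` of characteristic `p`, a normal integral separated `Z` of
finite type all of whose points have a RADICIALLY REGULAR open neighbourhood `U` (an integral
regular `W` maps onto `U` finitely, universally injectively, surjectively) satisfies the
conclusion of the crux `Pialt`. It is OPEN from dimension `4`; this file discharges it modulo the
route's crux `Picover` (stmt-ResolutionOfSingularities-0554), Piltant's two-model patching of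
proper models `ProperModel.TwoModelPatching p` (the atom of crux `PatchingRel`,
stmt-ResolutionOfSingularities-0642) and `NagataCompactification`:

* `hasResolution_opens_of_radiciallyRegular_perfectField` — **modulo `Picover`, a radicially
  regular open `U` of a normal variety over a perfect field is resolvable**: `U` is normal, so by
  Frobenius domination (`exists_frobeniusCover_of_finite_universallyInjective`) a scheme `N ≅ U`
  is a finite, universally injective, surjective cover of the REGULAR `W`; `Picover` resolves `N`.
* `radicialPatching_of_picover_of_twoModelPatching` — hence every point of `Z` has a resolvable
  open neighbourhood, `Z` is resolvable by Zariski-locality of weak resolution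
  (`hasResolution_of_forall_exists_open_hasResolution`, modulo `TwoModelPatching p` + Nagata), and a
  resolution is a purely inseparable regular alteration (`pialtConclusion_of_hasResolution`).
* `stub_radicialPatching_of_atoms` — the same with the three atoms in front of the stub's
  literal binders: `Picover → NagataCompactification → (∀ p, p.Prime → TwoModelPatching p) →
  ⟪stub_radicialPatching⟫`.

Census line for the lead: `RadicialPatching_p ⇐ Picover_p ∧ TwoModelPatching_p ∧ Nagata`; both
atoms are consequences of the summit (`PAlterationPicoverOfSummit`,
`ProperModel.twoModelPatching_of_resolutionInChar`), so nothing here proves more than the summit.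

Sources: M. Temkin, J. Algebra 373 (2013), Rem. 1.3.5 (i), (iii); J. Kollár, *Quotient spaces
modulo algebraic groups*, Ann. of Math. 145 (1997), Prop. 6.6 (Frobenius domination);
O. Piltant, RACSAM 107 (2013), Prop. 5.1; B. Conrad, J. Ramanujan Math. Soc. 22 (2007), Thm. 4.1.
-/

set_option linter.dupNamespace false -- mandated namespace of this single-conjunct summit

noncomputable section

open CategoryTheory CategoryTheory.Limits AlgebraicGeometry TopologicalSpace
open Literature.AlgebraicGeometry.Resolution
open Literature.AlgebraicGeometry.Morphisms (NagataCompactification)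

namespace Summit.ResolutionOfSingularities.ResolutionOfSingularities.Theorems.Pialt.RadiciallyRegular

section Assembly

open Summit.ResolutionOfSingularities.ResolutionOfSingularities.Theses.PAlteration (Picover)

/-- **A radicially regular open of a normal variety over a perfect field is resolvable, modulo
`Picover`.** Over a perfect field `k` of characteristic `p`, let `Z` be a NORMAL integral
separated `k`-scheme of finite type and `U ⊆ Z` an open dominated by an integral regular `W`
through a finite, universally injective, surjective `w : W → U`. By Frobenius domination
(`exists_frobeniusCover_of_finite_universallyInjective`: `U` is normal and `k` is perfect) some
scheme `N ≅ U` is a finite, universally injective, surjective cover of the REGULAR `W`, so the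
route's crux `Picover` (resolution of finite radicial covers of regular varieties) resolves `N`,
hence `U`. -/
theorem hasResolution_opens_of_radiciallyRegular_perfectField (hPc : Picover) {p : ℕ}
    (hp : p.Prime) (k : Type) [Field k] [CharP k p] [PerfectField k] (Z : Scheme.{0})
    [IsIntegral Z] (f : Z ⟶ Spec (.of k)) [IsSeparated f] [LocallyOfFiniteType f]
    [QuasiCompact f] (hN : ∀ z : Z, IsIntegrallyClosed (Z.presheaf.stalk z)) (U : Z.Opens)
    (hU : ∃ (W : Scheme.{0}) (h : W ⟶ (U : Scheme.{0})), IsIntegral W ∧ Scheme.IsRegular W ∧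
      IsFinite h ∧ UniversallyInjective h ∧ Function.Surjective h.base) :
    Scheme.HasResolution (U : Scheme.{0}) := by
  obtain ⟨W, w, hW, hreg, hfin, hui, hsurj⟩ := hU
  haveI := hW; haveI := hfin; haveI := hui
  haveI : Nonempty ((U : Z.Opens) : Scheme.{0}) := ⟨w (Classical.arbitrary W)⟩
  haveI : IsIntegral ((U : Z.Opens) : Scheme.{0}) := isIntegral_of_isOpenImmersion U.ι
  haveI : IsDominant w := ⟨hsurj.denseRange⟩
  have hUn : ∀ u : (U : Scheme.{0}), IsIntegrallyClosed ((U : Scheme.{0}).presheaf.stalk u) :=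
    isIntegrallyClosed_stalk_opens U hN
  haveI : IsLocallyNoetherian Z := LocallyOfFiniteType.isLocallyNoetherian f
  haveI : LocallyOfFiniteType (U.ι ≫ f) := inferInstance
  -- Frobenius domination: `N ≅ U` covers the regular `W` finitely, radicially, surjectively
  obtain ⟨N, ψ, φ, hNint, hφ, hψfin, hψui, hψsurj⟩ :=
    exists_frobeniusCover_of_finite_universallyInjective hp k W U (U.ι ≫ f) w hUn
  haveI := hNint; haveI := hφ; haveI := hψfin; haveI := hψui
  -- `Picover` resolves `N`
  haveI : IsSeparated (w ≫ U.ι ≫ f) := inferInstance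
  haveI : LocallyOfFiniteType (w ≫ U.ι ≫ f) := inferInstance
  haveI : QuasiCompact (w ≫ U.ι ≫ f) := inferInstance
  have hres : Scheme.HasResolution N :=
    hPc p hp k W N (w ≫ U.ι ≫ f) ψ inferInstance inferInstance inferInstance hW hreg hNint
      hψfin hψui hψsurj
  exact Scheme.HasResolution.of_iso φ hres

/-- **`stub_radicialPatching` from `Picover`, two-model patching and Nagata** (the stub of line
`SketchIdeator2` / Card A, `RadicialPatching_p`, discharged modulo the route's crux `Picover`
(stmt-ResolutionOfSingularities-0554), `ProperModel.TwoModelPatching p` (Piltant 2013, Prop. 5.1,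
`P = P_reg`; the atom of crux `PatchingRel`, stmt-ResolutionOfSingularities-0642) and
`NagataCompactification`). Over a perfect field of characteristic `p`, a NORMAL integral
separated scheme `Z` of finite type all of whose points have a radicially regular open
neighbourhood satisfies the conclusion of the crux `Pialt`: every such neighbourhood is resolvable
(`hasResolution_opens_of_radiciallyRegular_perfectField`), so `Z` is resolvable
(`hasResolution_of_forall_exists_open_hasResolution`), and a resolution is a purely inseparable
regular alteration (`pialtConclusion_of_hasResolution`). The binders after `hT` are those of the
registered stub, verbatim. -/
theorem radicialPatching_of_picover_of_twoModelPatching (hPc : Picover)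
    (hNag : NagataCompactification.{0}) (p : ℕ) (hp : p.Prime)
    (hT : ProperModel.TwoModelPatching.{0} p) (k : Type) [Field k] [CharP k p] [PerfectField k]
    (Z : Scheme.{0}) (f : Z ⟶ Spec (.of k)) [IsSeparated f] [LocallyOfFiniteType f]
    [QuasiCompact f] [IsIntegral Z] (hN : ∀ z : Z, IsIntegrallyClosed (Z.presheaf.stalk z))
    (hL : ∀ z : Z, ∃ U : Z.Opens, z ∈ U ∧ ∃ (W : Scheme.{0}) (h : W ⟶ (U : Scheme.{0})),
      IsIntegral W ∧ Scheme.IsRegular W ∧ IsFinite h ∧ UniversallyInjective h ∧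
        Function.Surjective h.base) :
    ∃ (Z' : Scheme.{0}) (g : Z' ⟶ Z), IsProper g ∧ IsIntegral Z' ∧ Scheme.IsRegular Z' ∧
      Function.Surjective g.base ∧ ∃ U : Z.Opens, Dense (U : Set Z) ∧ IsFinite (g ∣_ U) ∧
        UniversallyInjective (g ∣_ U) := by
  have hloc : ∀ z : Z, ∃ U : Z.Opens, z ∈ U ∧ Scheme.HasResolution (U : Scheme.{0}) := by
    intro z
    obtain ⟨U, hz, hU⟩ := hL z
    exact ⟨U, hz, hasResolution_opens_of_radiciallyRegular_perfectField hPc hp k Z f hN U hU⟩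
  exact pialtConclusion_of_hasResolution Z
    (hasResolution_of_forall_exists_open_hasResolution hNag hT k Z f hloc)

/-- The same with the three atoms in front of the stub's LITERAL signature (so that, given
`hPc hNag hT`, the registered stub `stub_radicialPatching` is this term applied to them):
`Picover → NagataCompactification → (∀ p, p.Prime → TwoModelPatching p) → ⟪stub_radicialPatching⟫`. -/
theorem stub_radicialPatching_of_atoms (hPc : Picover) (hNag : NagataCompactification.{0})
    (hT : ∀ p : ℕ, p.Prime → ProperModel.TwoModelPatching.{0} p)
    (p : ℕ) (hp : p.Prime) (k : Type) [Field k] [CharP k p]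
    [PerfectField k] (Z : Scheme.{0}) (f : Z ⟶ Spec (.of k)) [IsSeparated f]
    [LocallyOfFiniteType f] [QuasiCompact f] [IsIntegral Z]
    (hN : ∀ z : Z, IsIntegrallyClosed (Z.presheaf.stalk z))
    (hL : ∀ z : Z, ∃ U : Z.Opens, z ∈ U ∧ ∃ (W : Scheme.{0}) (h : W ⟶ (U : Scheme.{0})),
      IsIntegral W ∧ Scheme.IsRegular W ∧ IsFinite h ∧ UniversallyInjective h ∧
        Function.Surjective h.base) :
    ∃ (Z' : Scheme.{0}) (g : Z' ⟶ Z), IsProper g ∧ IsIntegral Z' ∧ Scheme.IsRegular Z' ∧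
      Function.Surjective g.base ∧ ∃ U : Z.Opens, Dense (U : Set Z) ∧ IsFinite (g ∣_ U) ∧
        UniversallyInjective (g ∣_ U) :=
  radicialPatching_of_picover_of_twoModelPatching hPc hNag p hp (hT p hp) k Z f hN hL

end Assembly

end Summit.ResolutionOfSingularities.ResolutionOfSingularities.Theorems.Pialt.RadiciallyRegular

end
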